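import Summits.AtomisticToContinuum.FouriersLaw.Theses.CageBudgetFekete
import Summits.AtomisticToContinuum.FouriersLaw.Theses.HoelderEscapeProfile
import Summits.AtomisticToContinuum.FouriersLaw.Theorems.HoelderEscapeProfileFibreCalculus
import Summits.AtomisticToContinuum.FouriersLaw.Theorems.CageBudgetFeketeUnboundedHeatVarianceAbelForm
import Summits.AtomisticToContinuum.FouriersLaw.Theorems.CageBudgetFeketeUnboundedHeatVarianceIrOfNoFrozenSiteEnergy
import HarnessLib

/-!
# `CageBudgetFekete.UnboundedHeatVariance` from the Hölder corner of route `HoelderEscapeProfile`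

Support file (`--supports stmt-AtomisticToContinuum-15771`, line `Sketch`, registered edge
`stub_unboundedHeatVariance_of_hoelderCorner`): the two open cruxes of route `HoelderEscapeProfile`,
K1 `LocalEnergyHalfHoelder` (`Ψ(ν) = S̄_ν(0) ≤ C√ν`) and K2 `CornerNoDip` (no dip of the fibred Abel conductivity
`𝒢_ν(k)` at `k = 0` on `|k| ≤ a√ν`), together with the LANDED twelve-clause fibre calculus
(`Theorems.FibreCalculusSketch.fibreCalculus_proof`), give a positive Abel floor
`A(ν) := ∫₀^∞ e^{-νt} C_T(t) dt ≥ c₁ > 0` for all small `ν > 0` (the wavenumber pigeonhole of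
`HoelderEscapeProfile.closes`, first half of its local lemma `corner`: some `0 < k⋆ ≤ a√ν` has `f̂_ν(k⋆) ≤ χ/2`,
the fibre identity `χ(k) − f̂_ν(k) = (2 − 2cos k)𝒢_ν(k)/ν` gives `𝒢_ν(k⋆) ≥ 2c₁`, and K2 moves it to `k = 0`).
Hence `ν⁻¹ A(ν) ≥ c₁/ν → +∞`, which is the Abel form of U
(`Theorems.UnboundedHeatVariance.Birth.unboundedHeatVariance_iff_abel`, landed).

Pure port of the in-tree script of `HoelderEscapeProfile.closes` (no `AbelSpreadCeiling`, no `AbelRegularity`); the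
continuity of the cosine series `f̂_ν`, `χ` is the landed `Sketch.cosSeries_continuous`.
-/

noncomputable section

namespace Summit.AtomisticToContinuum.FouriersLaw.Theorems.UnboundedHeatVariance.Sketch

open MeasureTheory Set Filter Topology
open Literature.MathematicalPhysics.KineticTheory.HeatConduction

/-- **Abel corner floor (wavenumber pigeonhole; pure real analysis).** Abstract first half of the local lemma
`corner` of `HoelderEscapeProfile.closes`: if `f̂_ν ≥ 0` is continuous with `f̂_ν(0) = χ(0) > 0`,
`∫_{-π}^{π} f̂_ν = 2πΨ(ν)`, `Ψ(ν) ≤ C√ν` for `0 < ν ≤ ν₀`, `χ` is continuous at `0`, the fibre identity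
`χ(k) − f̂_ν(k) = (2 − 2cos k)𝒢_ν(k)/ν` holds, `A(ν) = 𝒢_ν(0)` and `𝒢_ν` has no dip at `0` on every parabolic
scale, then `A(ν) ≥ c₁ := χ³/(512π²C'²)` (`C' = max C 1`) eventually as `ν ↓ 0`. [folklore] -/
theorem abelCornerFloor (A Ψ χk : ℝ → ℝ) (fh Gh : ℝ → ℝ → ℝ) (C ν₀ : ℝ)
    (hχ : 0 < χk 0) (hχc : ContinuousAt χk 0) (hfc : ∀ ν, 0 < ν → Continuous (fh ν))
    (hf0 : ∀ ν, 0 < ν → fh ν 0 = χk 0) (hfn : ∀ ν, 0 < ν → ∀ k, 0 ≤ fh ν k)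
    (hfi : ∀ ν, 0 < ν → ∫ k in (-Real.pi)..Real.pi, fh ν k = 2 * Real.pi * Ψ ν)
    (hν₀ : 0 < ν₀) (hK1 : ∀ ν, 0 < ν → ν ≤ ν₀ → Ψ ν ≤ C * Real.sqrt ν)
    (hid : ∀ ν, 0 < ν → ∀ k, χk k - fh ν k = (2 - 2 * Real.cos k) * Gh ν k / ν)
    (hA : ∀ ν, 0 < ν → A ν = Gh ν 0)
    (hND : ∀ a : ℝ, 0 < a → ∀ ε : ℝ, 0 < ε → ∃ ν₂ : ℝ, 0 < ν₂ ∧ ∀ ν, 0 < ν → ν ≤ ν₂ →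
      ∀ k, |k| ≤ a * Real.sqrt ν → Gh ν k ≤ Gh ν 0 + ε) :
    ∃ c₁ : ℝ, 0 < c₁ ∧ ∀ᶠ ν in 𝓝[>] (0:ℝ), c₁ ≤ A ν := by
  -- adapted from `Summit.AtomisticToContinuum.FouriersLaw.Theses.HoelderEscapeProfile.closes` (local lemma `corner`)
  set χ := χk 0
  set C' := max C 1 with hC'
  have hC'p : 0 < C' := lt_of_lt_of_le one_pos (le_max_right _ _)
  set a := 8 * Real.pi * C' / χ with ha
  have hap : 0 < a := by positivity
  set c₁ := χ ^ 3 / (512 * Real.pi ^ 2 * C' ^ 2) with hc₁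
  have hc₁p : 0 < c₁ := by positivity
  obtain ⟨ν₂, hν₂, hND'⟩ := hND a hap c₁ hc₁p
  obtain ⟨δ, hδ, hδχ⟩ : ∃ δ > 0, ∀ k, |k| < δ → |χk k - χ| < χ / 4 := by
    obtain ⟨δ, hδ, h⟩ := Metric.continuousAt_iff.mp hχc (χ / 4) (by positivity)
    exact ⟨δ, hδ, fun k hk => by simpa [Real.dist_eq] using h (by simpa [Real.dist_eq] using hk)⟩
  have hlow : ∀ ν, 0 < ν → ν ≤ ν₀ → ν ≤ ν₂ → a * Real.sqrt ν < δ → a * Real.sqrt ν ≤ Real.pi →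
      c₁ ≤ A ν := by
    intro ν hν h0 h2 hKδ hKπ
    set K := a * Real.sqrt ν with hK
    have hsq : 0 < Real.sqrt ν := Real.sqrt_pos.mpr hν
    have hKp : 0 < K := mul_pos hap hsq
    have hΨ : Ψ ν ≤ C' * Real.sqrt ν :=
      (hK1 ν hν h0).trans (mul_le_mul_of_nonneg_right (le_max_left _ _) hsq.le)
    obtain ⟨k, ⟨hk0, hkK⟩, hfk⟩ : ∃ k ∈ Ioc (0:ℝ) K, fh ν k ≤ χ / 2 := by
      by_contra H
      push Not at H
      have hge : ∀ k ∈ Icc (0:ℝ) K, χ / 2 ≤ fh ν k := fun k hk => by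
        rcases eq_or_lt_of_le hk.1 with h | h
        · rw [← h, hf0 ν hν]; linarith
        · exact (H k ⟨h, hk.2⟩).le
      have h1 : ∫ k in (0:ℝ)..K, (χ / 2 : ℝ) ≤ ∫ k in (0:ℝ)..K, fh ν k :=
        intervalIntegral.integral_mono_on hKp.le (by simp) ((hfc ν hν).intervalIntegrable _ _) hge
      rw [intervalIntegral.integral_const, smul_eq_mul, sub_zero] at h1
      have h2 : ∫ k in (0:ℝ)..K, fh ν k ≤ ∫ k in (-Real.pi)..Real.pi, fh ν k :=
        intervalIntegral.integral_mono_interval (neg_nonpos.mpr Real.pi_pos.le) hKp.le hKπ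
          (Eventually.of_forall fun k => hfn ν hν k) ((hfc ν hν).intervalIntegrable _ _)
      rw [hfi ν hν] at h2
      have h3 : K * (χ / 2) = 4 * Real.pi * C' * Real.sqrt ν := by rw [hK, ha]; field_simp; ring
      have h4 : 0 < Real.pi * C' * Real.sqrt ν := by positivity
      nlinarith [h1, h2, hΨ, Real.pi_pos]
    have hc1 : Real.cos k < 1 := by
      have := Real.cos_lt_cos_of_nonneg_of_le_pi le_rfl (hkK.trans hKπ) hk0; rwa [Real.cos_zero] at this
    set d := 2 - 2 * Real.cos k with hd
    have hdp : 0 < d := by rw [hd]; linarith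
    have hdk : d ≤ a ^ 2 * ν := by
      have e1 := Real.one_sub_sq_div_two_le_cos (x := k)
      have e2 : k ^ 2 ≤ K ^ 2 := pow_le_pow_left₀ hk0.le hkK 2
      rw [hK, mul_pow, Real.sq_sqrt hν.le] at e2; rw [hd]; linarith
    have hχk : 3 * χ / 4 ≤ χk k := by
      have := hδχ k (by rw [abs_of_pos hk0]; exact lt_of_le_of_lt hkK hKδ)
      rw [abs_lt] at this; linarith [this.1]
    have hpr : χ / 4 * ν ≤ d * Gh ν k := by
      have e : (χk k - fh ν k) * ν = d * Gh ν k := by rw [hid ν hν k, hd]; field_simp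
      rw [← e]; exact mul_le_mul_of_nonneg_right (by linarith) hν.le
    have hG2 : 2 * c₁ ≤ Gh ν k := by
      have e1 : Gh ν k = d * Gh ν k / d := by field_simp
      have e2 : χ / 4 * ν / d ≤ d * Gh ν k / d := div_le_div_of_nonneg_right hpr hdp.le
      have e3 : χ / 4 * ν / (a ^ 2 * ν) ≤ χ / 4 * ν / d := div_le_div_of_nonneg_left (by positivity) hdp hdk
      have e4 : χ / 4 * ν / (a ^ 2 * ν) = 2 * c₁ := by rw [ha, hc₁]; field_simp; ring
      linarith
    have := hND' ν hν h2 k (by rw [abs_of_pos hk0]; exact hkK)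
    rw [hA ν hν]; linarith
  have hpos : ∀ᶠ ν in 𝓝[>] (0:ℝ), 0 < ν := eventually_mem_nhdsWithin
  have hsm : ∀ᶠ ν in 𝓝[>] (0:ℝ), ν < min ν₀ ν₂ := nhdsWithin_le_nhds (Iio_mem_nhds (by positivity))
  have hKev : ∀ᶠ ν in 𝓝[>] (0:ℝ), a * Real.sqrt ν < min δ Real.pi := by
    have : Tendsto (fun ν : ℝ => a * Real.sqrt ν) (𝓝 (0:ℝ)) (𝓝 (a * Real.sqrt 0)) :=
      (continuous_const.mul Real.continuous_sqrt).tendsto 0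
    rw [Real.sqrt_zero, mul_zero] at this
    exact (this.mono_left nhdsWithin_le_nhds).eventually (gt_mem_nhds (lt_min hδ Real.pi_pos))
  refine ⟨c₁, hc₁p, ?_⟩
  filter_upwards [hpos, hsm, hKev] with ν hν hs hK
  exact hlow ν hν (hs.le.trans (min_le_left _ _)) (hs.le.trans (min_le_right _ _))
    (lt_of_lt_of_le hK (min_le_left _ _)) (hK.le.trans (min_le_right _ _))

/-- A positive floor `A(ν) ≥ c₁ > 0` eventually as `ν ↓ 0` gives the Abel divergence `ν⁻¹ A(ν) → +∞`.
[folklore] -/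
theorem tendsto_inv_mul_atTop_of_floor (A : ℝ → ℝ) {c₁ : ℝ} (hc₁ : 0 < c₁)
    (h : ∀ᶠ ν in 𝓝[>] (0:ℝ), c₁ ≤ A ν) :
    Tendsto (fun ν : ℝ => ν⁻¹ * A ν) (𝓝[>] 0) atTop := by
  have h1 : Tendsto (fun ν : ℝ => c₁ * ν⁻¹) (𝓝[>] 0) atTop :=
    Tendsto.const_mul_atTop hc₁ tendsto_inv_nhdsGT_zero
  refine tendsto_atTop_mono' _ ?_ h1
  filter_upwards [h, (eventually_mem_nhdsWithin : ∀ᶠ ν in 𝓝[>] (0:ℝ), ν ∈ Ioi 0)] with ν hν hpos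
  calc c₁ * ν⁻¹ = ν⁻¹ * c₁ := mul_comm _ _
    _ ≤ ν⁻¹ * A ν := mul_le_mul_of_nonneg_left hν (inv_nonneg.2 (le_of_lt hpos))

/-- **Edge `HoelderEscapeProfile` K1 ∧ K2 ⟹ U** (registered stub `stub_unboundedHeatVariance_of_hoelderCorner` of
line `Sketch` of crux `CageBudgetFekete.UnboundedHeatVariance`). The ½-Hölder on-site Abel return (K1) and the
no-dip corner condition (K2), with the LANDED fibre calculus, give a positive Abel–Green–Kubo floor
`A(ν) ≥ χ³/(512π²C'²)` for small `ν` (`abelCornerFloor`), hence `ν⁻¹A(ν) → +∞`, which is U in Abel form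
(`Birth.unboundedHeatVariance_iff_abel`). -/
theorem stub_unboundedHeatVariance_of_hoelderCorner :
    Summit.AtomisticToContinuum.FouriersLaw.Theses.HoelderEscapeProfile.LocalEnergyHalfHoelder → Summit.AtomisticToContinuum.FouriersLaw.Theses.HoelderEscapeProfile.CornerNoDip → Summit.AtomisticToContinuum.FouriersLaw.Theses.CageBudgetFekete.UnboundedHeatVariance := by
  intro hK1 hND
  refine (Summit.AtomisticToContinuum.FouriersLaw.Theorems.UnboundedHeatVariance.Birth.unboundedHeatVariance_iff_abel).2 ?_
  intro ω₂ lam β γ hω hl hβ T hT μ hG hSI hRefl D hP hShift hAC _hCc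
  set h : ChainConfig → ℤ → ℝ :=
    fun σ x => (σ x).2 ^ 2 / 2 + (pinnedChain ω₂ lam β γ).U (σ x).1 +
      ((pinnedChain ω₂ lam β γ).V ((σ (x + 1)).1 - (σ x).1) + (pinnedChain ω₂ lam β γ).V ((σ x).1 - (σ (x - 1)).1)) / 2
    with hh
  set S : ℤ → ℝ → ℝ := fun x t => ∫ σ, (h σ 0 - ∫ σ', h σ' 0 ∂μ) * (h (D.flow t σ) x - ∫ σ', h σ' 0 ∂μ) ∂μ with hS
  set Sb : ℝ → ℤ → ℝ := fun ν x => ν * ∫ t in Set.Ioi (0:ℝ), Real.exp (-(ν * t)) * S x t with hSb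
  set G : ℤ → ℝ → ℝ :=
    fun x t => ∫ σ, (pinnedChain ω₂ lam β γ).bondCurrentZ σ 0 * (pinnedChain ω₂ lam β γ).bondCurrentZ (D.flow t σ) x ∂μ
    with hGd
  set Gh : ℝ → ℝ → ℝ := fun ν k => ∫ t in Set.Ioi (0:ℝ), Real.exp (-(ν * t)) * ∑' x : ℤ, Real.cos (k * (x : ℝ)) * G x t
    with hGh
  set fh : ℝ → ℝ → ℝ := fun ν k => ∑' x : ℤ, Real.cos (k * (x : ℝ)) * Sb ν x with hfh
  set χk : ℝ → ℝ := fun k => ∑' x : ℤ, Real.cos (k * (x : ℝ)) * S x 0 with hχk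
  obtain ⟨-, -, hIntS, hSumSb, hSumS0, hχpos, hcons, hBoch, hPars, hIntG, hId, -⟩ :=
    Summit.AtomisticToContinuum.FouriersLaw.Theorems.FibreCalculusSketch.fibreCalculus_proof ω₂ lam β γ hω hl hβ T hT
      μ hG hSI hRefl D hP hShift h hh S hS Sb hSb G hGd Gh hGh fh hfh χk hχk
  obtain ⟨C, ν₀, hν₀, hK1'⟩ := hK1 ω₂ lam β γ hω hl hβ T hT μ hG hSI hRefl D hP hShift h hh S hS (hIntS 0)
  obtain ⟨c₁, hc₁, hfloor⟩ := abelCornerFloor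
    (fun ν => ∫ t in Set.Ioi (0:ℝ), Real.exp (-(ν * t)) * D.currentCorrelation μ t)
    (fun ν => Sb ν 0) χk fh Gh C ν₀
    hχpos (by rw [hχk]; exact (cosSeries_continuous _ hSumS0).continuousAt)
    (fun ν hν => by rw [hfh]; exact cosSeries_continuous _ (hSumSb ν hν))
    (fun ν hν => by simp only [hfh, zero_mul, Real.cos_zero, one_mul]; exact hcons ν hν)
    hBoch hPars hν₀ hK1' hId (fun ν _ => by simp only [hGh, hGd, zero_mul, Real.cos_zero, one_mul]; rfl)
    (hND ω₂ lam β γ hω hl hβ T hT μ hG hSI hRefl D hP hShift G hGd Gh hGh hAC hIntG)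
  exact tendsto_inv_mul_atTop_of_floor _ hc₁ hfloor

end Summit.AtomisticToContinuum.FouriersLaw.Theorems.UnboundedHeatVariance.Sketch

end
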